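import Mathlib.RingTheory.Valuation.ValuationSubring
import Mathlib.RingTheory.RegularLocalRing.Defs
import Mathlib.RingTheory.Localization.AtPrime.Basic
import Mathlib.RingTheory.Localization.Submodule
import Mathlib.RingTheory.FiniteType
import Mathlib.RingTheory.Bezout
import Mathlib.RingTheory.Adjoin.FG
import HarnessLib

/-!
# Local uniformization is free at valuation rings essentially of finite type

Topic: `Literature/AlgebraicGeometry/Resolution`. Load-bearing analysis recorded by the standing
disprover of crux `PatchingRel` (stmt-ResolutionOfSingularities-0642, `LUrel_p → ResolutionInChar p`;
`Cruxes/PatchingRel/Disproof.lean` §2 (H7)), folklore: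

* `lurel_of_essFiniteType` — let `O` be a valuation ring of `K/k` which is a localisation of a
  finitely generated `k`-subalgebra `B ⊆ O` (every `x ∈ O` is `b · s⁻¹` with `b, s ∈ B` and `s` a
  unit of `O`) — e.g. a DIVISORIAL valuation (`O = B_𝔭`, `B` a normal affine model, `ht 𝔭 = 1`) or
  the trivial one. Then the conclusion of relative local uniformization holds at `O` for EVERY
  finitely generated `R ⊆ O`, in every dimension and characteristic, with `A := R ⊔ B`: the
  localisation of `A` at the centre of `O` is `O` itself, which is then a valuation ring essentially
  of finite type over a field — Noetherian (a localisation of a finitely generated algebra), Bézout,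
  hence a principal ideal domain, hence a regular local ring (a discrete valuation ring or a field).

Consequence for the crux: the antecedent `LUrel_p` has content only at valuation rings that are
NOT essentially of finite type over `k` (non-divisorial valuations: rank `> 1`, rational rank or
residual transcendence defect, or positive defect); any proof of `PatchingRel` feeding its
hypothesis only divisorial valuations proves `ResolutionInChar p` outright.

## Sources

* O. Zariski, P. Samuel, *Commutative Algebra* II, Ch. VI §14 (prime divisors; divisorial
  valuation rings are localisations of normal models). [ZariskiSamuel1960] The lemma itself is
  folklore.
-/

open IsLocalRing

namespace Literature.AlgebraicGeometry.Resolution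

universe u v

/-- **Relative local uniformization is free at a valuation ring essentially of finite type.** If
the valuation ring `O ⊇ k` of `K` is a localisation of a finitely generated `k`-subalgebra
`B ⊆ O` (hypothesis `hloc`: every element of `O` is `b · s⁻¹` with `b, s ∈ B`, `s ≠ 0`,
`s⁻¹ ∈ O`), then for every finitely generated `R ⊆ O` the finitely generated algebra `A := R ⊔ B`
satisfies `R ≤ A ⊆ O` and `A` localised at the centre `m_O ∩ A` is a regular local ring — indeed
that localisation is isomorphic to `O`, a Noetherian valuation ring. [folklore] -/
theorem lurel_of_essFiniteType {k : Type u} {K : Type v} [Field k] [Field K] [Algebra k K]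
    (O : ValuationSubring K) (B : Subalgebra k K) (hBfg : B.FG) (hBO : B.toSubring ≤ O.toSubring)
    (hloc : ∀ x : K, x ∈ O → ∃ b ∈ B, ∃ s ∈ B, s ≠ 0 ∧ s⁻¹ ∈ O ∧ x = b * s⁻¹)
    (R : Subalgebra k K) (hRfg : R.FG) (hRO : R.toSubring ≤ O.toSubring) :
    ∃ (A : Subalgebra k K) (h : A.toSubring ≤ O.toSubring), R ≤ A ∧ B ≤ A ∧ A.FG ∧
      IsRegularLocalRing (Localization.AtPrime
        (Ideal.comap (Subring.inclusion h) (IsLocalRing.maximalIdeal O))) := by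
  classical
  -- the model `A := R ⊔ B ⊆ O`
  let Oalg : Subalgebra k K := { O.toSubring with algebraMap_mem' := fun c => hBO (B.algebraMap_mem c) }
  have hAO : (R ⊔ B).toSubring ≤ O.toSubring := by
    change R ⊔ B ≤ Oalg
    exact sup_le (fun x hx => hRO hx) (fun x hx => hBO hx)
  refine ⟨R ⊔ B, hAO, le_sup_left, le_sup_right, hRfg.sup hBfg, ?_⟩
  set A := R ⊔ B with hA_def
  let ι : ↥A.toSubring →+* ↥O.toSubring := Subring.inclusion hAO
  set P : Ideal ↥A.toSubring := Ideal.comap ι (maximalIdeal O) with hP_def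
  set S := Localization.AtPrime P
  -- the inclusion `A → O` inverts `P.primeCompl`
  have hunit : ∀ y : P.primeCompl, IsUnit (ι y) := by
    intro y
    have hy : ι y ∉ maximalIdeal ↥O := fun h => y.2 h
    have : IsUnit (show ↥O from ι y) := by
      by_contra hnu
      exact hy hnu
    exact this
  let φ : S →+* ↥O.toSubring := IsLocalization.lift (M := P.primeCompl) hunit
  -- `φ` is bijective
  have hφinj : Function.Injective φ := by
    rw [injective_iff_map_eq_zero]
    intro z hz
    obtain ⟨⟨a, s⟩, rfl⟩ := IsLocalization.mk'_surjective P.primeCompl z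
    change IsLocalization.mk' S a s = 0
    change φ (IsLocalization.mk' S a s) = 0 at hz
    rw [IsLocalization.lift_mk'] at hz
    have ha : ι a = 0 := (Units.mul_left_eq_zero _).mp hz
    have ha0 : a = 0 := by
      have : ((ι a : ↥O.toSubring) : K) = 0 := by rw [ha]; rfl
      exact Subtype.ext this
    rw [ha0, IsLocalization.mk'_zero]
  have hφsurj : Function.Surjective φ := by
    intro x
    obtain ⟨b, hb, s, hs, hs0, hsinv, hx⟩ := hloc x x.2
    have hbA : b ∈ A := le_sup_right (α := Subalgebra k K) hb
    have hsA : s ∈ A := le_sup_right (α := Subalgebra k K) hs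
    have hsP : (⟨s, hsA⟩ : ↥A.toSubring) ∈ P.primeCompl := by
      intro hsP'
      have h' : ¬ IsUnit (show ↥O from ι ⟨s, hsA⟩) := hsP'
      apply h'
      refine ⟨⟨(show ↥O from ι ⟨s, hsA⟩), (⟨s⁻¹, hsinv⟩ : ↥O), ?_, ?_⟩, rfl⟩
      · exact Subtype.ext (mul_inv_cancel₀ hs0)
      · exact Subtype.ext (inv_mul_cancel₀ hs0)
    refine ⟨IsLocalization.mk' S (⟨b, hbA⟩ : ↥A.toSubring) ⟨⟨s, hsA⟩, hsP⟩, ?_⟩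
    rw [IsLocalization.lift_mk']
    apply Subtype.ext
    change b * ((((hunit ⟨⟨s, hsA⟩, hsP⟩).unit⁻¹ : (↥O.toSubring)ˣ) : ↥O.toSubring) : K) = (x : K)
    have hinv : ((((hunit ⟨⟨s, hsA⟩, hsP⟩).unit⁻¹ : (↥O.toSubring)ˣ) : ↥O.toSubring) : K) = s⁻¹ := by
      have h1 : (((hunit ⟨⟨s, hsA⟩, hsP⟩).unit : (↥O.toSubring)ˣ) : ↥O.toSubring) * 
          (((hunit ⟨⟨s, hsA⟩, hsP⟩).unit⁻¹ : (↥O.toSubring)ˣ) : ↥O.toSubring) = 1 := Units.mul_inv _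
      have h2 := congrArg (fun t : ↥O.toSubring => (t : K)) h1
      simp only [Subring.coe_mul, Subring.coe_one] at h2
      have h3 : ((((hunit ⟨⟨s, hsA⟩, hsP⟩).unit : (↥O.toSubring)ˣ) : ↥O.toSubring) : K) = s := rfl
      rw [h3] at h2
      exact (eq_inv_of_mul_eq_one_right h2)
    rw [hinv, hx]
  let e : S ≃+* ↥O.toSubring := RingEquiv.ofBijective φ ⟨hφinj, hφsurj⟩
  -- `O` is Noetherian (≅ a localisation of the finitely generated `A`), Bézout, local, a domain
  haveI : Algebra.FiniteType k ↥A := A.fg_iff_finiteType.mp (hRfg.sup hBfg)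
  haveI : IsNoetherianRing ↥A.toSubring := Algebra.FiniteType.isNoetherianRing k ↥A
  haveI : IsNoetherianRing S := IsLocalization.isNoetherianRing P.primeCompl S inferInstance
  haveI : IsNoetherianRing ↥O.toSubring := isNoetherianRing_of_ringEquiv S e
  haveI : ValuationRing ↥O.toSubring := inferInstanceAs (ValuationRing O)
  haveI : IsLocalRing ↥O.toSubring := inferInstanceAs (IsLocalRing O)
  haveI : IsDomain ↥O.toSubring := inferInstance
  haveI : IsBezout ↥O.toSubring := inferInstance
  haveI : IsPrincipalIdealRing ↥O.toSubring := inferInstance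
  haveI : IsRegularLocalRing ↥O.toSubring := inferInstance
  exact IsRegularLocalRing.of_ringEquiv e.symm

end Literature.AlgebraicGeometry.Resolution
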